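import Summits.ValiantsHypothesis.ValiantsHypothesis.Theorems.ClassTransfer.Negative.Fermionant
import Summits.ValiantsHypothesis.ValiantsHypothesis.Theorems.ClassTransfer.Negative.FermionantVNP

/-!
# Crux `ClassTransfer` (stmt-ValiantsHypothesis-7287) is SUMMIT-HARD ON ITS OWN:
# `ClassTransfer → ValiantsHypothesis`

Lead prover (gen 1) of line `registered`, closing calibration of the crux
`Summit.ValiantsHypothesis.ValiantsHypothesis.Theses.FermionizationDimension.ClassTransfer`
("every `VP` class-function family `χ` has commutative twisting realisations of `sgn · χ_n` of
quasi-polynomial dimension").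

* `Negative/Fermionant.lean` (`not_isVPFamily_fermionant_of_classTransfer`): the crux, applied to
  the class function `sgn · 2^{c}` (`2^{c(σ)} = #{f : [n] → [2] | f ∘ σ = f}`), would realise
  `2^{c}` in quasi-polynomial dimension, but every realisation on `S_{4t}` has dimension
  `≥ C(2t, t)`; so `ClassTransfer ⇒ Fer_2 ∉ VP`, `Fer_2 = Σ_σ sgn(σ) 2^{c(σ)} x^σ`.
* `Negative/FermionantVNP.lean` (`isVNPFamily_fermionant_two`): `Fer_2 ∈ VNP`
  (`Fer_2 = Σ_{e ∈ {0,1}^n} det(x_ij [e_i = e_j])`).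
* Hence `valiantsHypothesis_of_classTransfer`: **`ClassTransfer → VP_ℂ ≠ VNP_ℂ`**, through the
  bundling bridges `mem_VP_ofFintype_iff_holds` / `mem_VNP_ofFintype_iff_holds`.

Consequences for route `FermionizationDimension` (planner's business, recorded here as the
lead's release note): the route's deciding theorem `SDimPerNotQP → ClassTransfer → VH` does not
use `SDimPerNotQP` in any essential way — `ClassTransfer` alone is (at least) the summit, so the
route is not a decomposition of `ValiantsHypothesis`; every line for this crux is summit-hard
(not only the cone line `registered`, cf. `Negative/ConeLevel.lean`, `Negative/ObliviousSplit.lean`);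
and the crux cannot be REFUTED without refuting `VP ≠ VNP`-type lower bounds either
(`Negative/FalsifierPerHard.lean`, `Negative/CoverBalance*.lean`: all recorded falsifiers are
permanent-hard).  Its honest status: an open problem sandwiched as
`VH ⇐ ClassTransfer`, `ClassTransfer` unrefuted. [folklore]
-/

set_option linter.dupNamespace false

noncomputable section

namespace Summit.ValiantsHypothesis.ValiantsHypothesis.Theorems.ClassTransfer.Negative

open Equiv Finset
open Literature.Computability.AlgebraicComplexity

/-- **The crux `ClassTransfer` implies Valiant's hypothesis by itself.**  If `VP = VNP` then the
2-fermionant family, which is in `VNP` (`isVNPFamily_fermionant_two`), would be a `VP` family,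
contradicting `not_isVPFamily_fermionant_of_classTransfer` (at `k = 0`, two colours). [folklore] -/
theorem valiantsHypothesis_of_classTransfer
    (hCT : Summit.ValiantsHypothesis.ValiantsHypothesis.Theses.FermionizationDimension.ClassTransfer) :
    _root_.ValiantsHypothesis := by
  show VP ℂ ≠ VNP ℂ
  intro hEq
  have hVNP : PolyFamily.ofFintype (fun n => ∑ σ : Perm (Fin n),
      MvPolynomial.C (((Perm.sign σ : ℤ) : ℂ) *
          ((univ.filter fun f : Fin n → Fin 2 => ∀ x, f (σ x) = f x).card : ℂ)) *
        ∏ i : Fin n, MvPolynomial.X (σ i, i)) ∈ VNP ℂ :=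
    (mem_VNP_ofFintype_iff_holds _).2 isVNPFamily_fermionant_two
  have hVP : PolyFamily.ofFintype (fun n => ∑ σ : Perm (Fin n),
      MvPolynomial.C (((Perm.sign σ : ℤ) : ℂ) *
          ((univ.filter fun f : Fin n → Fin 2 => ∀ x, f (σ x) = f x).card : ℂ)) *
        ∏ i : Fin n, MvPolynomial.X (σ i, i)) ∈ VP ℂ := by
    rw [hEq]; exact hVNP
  have hfam := (mem_VP_ofFintype_iff_holds _).1 hVP
  exact not_isVPFamily_fermionant_of_classTransfer hCT 0 hfam

/-- The route's deciding shape with the redundant hypothesis dropped: `ClassTransfer` already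
gives the summit, so `SDimPerNotQP → ClassTransfer → ValiantsHypothesis` (the route's `Assembly`)
holds with its first hypothesis unused. [folklore] -/
theorem assembly_of_classTransfer_alone :
    Summit.ValiantsHypothesis.ValiantsHypothesis.Theses.FermionizationDimension.SDimPerNotQP →
      Summit.ValiantsHypothesis.ValiantsHypothesis.Theses.FermionizationDimension.ClassTransfer →
        _root_.ValiantsHypothesis :=
  fun _ hCT => valiantsHypothesis_of_classTransfer hCT

end Summit.ValiantsHypothesis.ValiantsHypothesis.Theorems.ClassTransfer.Negative
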